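import Mathlib.Analysis.SpecialFunctions.ExpDeriv
import Literature.Barriers.CriticalPhenomena.RigorousRGSmallParameterTestFunctionNorm
import HarnessLib

/-!
# `RigorousRGSmallParameter` (Slade, Theorem 1.4.1): the `T_φ` seminorm of [BS-rg-norm] —
# IV. The commutative algebra `(𝓕, ⋆)`, the exponential formula, and
# Brydges–Slade Proposition 3.4.6 (`‖e^{-F}‖_{T_φ} ≤ e^{-2F_∅(φ) + ‖F‖_{T_φ}}`)

Sequel of `RigorousRGSmallParameterTphiSeminorm.lean`, `…TphiCalculus.lean`,
`…TestFunctionNorm.lean` (see the first for the sources and architecture). Brydges–Slade,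
Proposition 3.4.6: "Let `F ∈ 𝒩` and let `F_∅` be the purely bosonic part of `F`. Then
`‖e^{-F}‖_{T_φ} ≤ e^{-2Re F_∅(φ) + ‖F‖_{T_φ}`" — the estimate behind every stability bound of the
method ([BS-rg-IE]); with the product property (Proposition 3.4.5, file III) these are the two
properties of the `T_φ` seminorm used throughout Slade's §9 ("Proof of Theorem 1.4.2") and in
[BS-rg-IE, BS-rg-step] for his Theorem 6.3.1.

## The proof formalised here

The printed proof (§5.2 of [BS-rg-norm]) bounds `‖1 - F/N‖_{T_φ} ≤ 1 - (2/N)Re F_∅ + ‖F‖/N`,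
takes the `N`-th power with the product property and passes to the limit `N → ∞` inside the
seminorm. Here the limit is avoided by an exact formula for the coefficients of `e^G`, proved
algebraically in the semi-normed algebra `(𝓕, ⋆)` of file I:

1. `⋆` is commutative and associative (`star_comm`, `star_assoc`: induction on the sequence, the
   shift `(S_aF)_z = F_{a·z}` being a derivation of `⋆`, `star_cons`), with unit `δ_∅` (`unitFam`)
   and powers `G^{⋆k}` (`starPow`; `(G^{⋆k})_z = 0` for `|z| < k` when `G_∅ = 0`).
2. On families of functions of the field, the shift `S_a` and the entrywise derivative
   `(D_vF)_z = ∂_vF_z` are both derivations of the pointwise `⋆` (`shiftFam_starF`,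
   `derivFam_starF`), so `S_a(G^{⋆(k+1)}) = (k+1)S_aG ⋆ G^{⋆k}` and likewise for `D_v`
   (`shiftFam_starPowF`, `derivFam_starPowF`); hence for the truncated `⋆`-exponential
   `P = Σ_{k≤K} G^{⋆k}/k!` (`expStar`): `S_aP = S_aG ⋆ P - S_aG ⋆ G^{⋆K}/K!` and the same with `D_v`.
3. For `G ∈ 𝒩` smooth let `G_1` be its coefficient family without the constant term
   (`tailCoeff`). Then `S_aG_1 = D_{e_a}G_1 + (∂_aG)δ_∅` (`shiftFam_tailCoeff`), and with
   `K = p_𝒩 + 1` the `G^{⋆K}` terms vanish on `|z| ≤ p_𝒩`, giving the recursion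
   `(S_aP)_z = (D_{e_a}P)_z + (∂_aG)P_z` (`shiftFam_expStar_tailCoeff`) — the recursion satisfied by
   `e^{-G}(e^G)_z`. Induction on `z`: **`(e^G)_z = e^G P_z`** for `|z| ≤ p_𝒩` (`coeff_exp`, the
   exponential / Faà di Bruno formula).
4. At the field `φ`: `‖e^G‖_{T_φ} ≤ e^{G(φ)} Σ_k ‖(G_1(φ))^{⋆k}‖_T/k! ≤ ‖δ_∅‖_T e^{G(φ)} e^{‖G_1(φ)‖_T}`
   (`TphiNorm_exp_le`: product property of file I, `Σ_{k≤K} x^k/k! ≤ e^x`), and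
   `|G(φ)| + ‖G_1(φ)‖_T ≤ ‖G‖_{T_φ}` (`abs_nil_add_Tnorm_tailFam_le`) whenever the unit ball of test
   functions is decomposable at the empty sequence (`NilDecomposable`: resetting `g_∅` and
   negating the rest preserve `B(Φ)` — true for the lattice norms, `latticeFamily_nilDecomposable`).
   With `G = -F`: `-F(φ) - |F(φ)| ≤ -2F(φ)`.

## What this file proves (everything; no named fact)

* `star_comm`, `star_assoc`, `unitFam`, `starPow`, …; `Tnorm_smul_le`, `Tnorm_sum_le`,
  `Tnorm_starPow_le`, `Tnorm_congr`, `tailFam`, `abs_nil_add_Tnorm_tailFam_le`;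
* `starF`, `derivFam`, `starPowF`, `expStar`, `tailCoeff` and the derivation identities above;
  **`coeff_exp`** (exponential formula);
* **`TphiNorm_exp_neg_le`** — Proposition 3.4.6 (real case) for any family of test functionals
  with the shuffle property, bounded unit ball and decomposable at `∅`, with the factor `‖δ_∅‖_T`
  (`= 1` for the lattice norms); `TphiNorm_exp_neg_le'` (`≤ ‖δ_∅‖_T e^{|F(φ)|+‖F‖_{T_φ}}`, no
  decomposability);
* for Slade's `T_{φ,j}(𝔥_j)`: **`TphiNorm_exp_neg_le_lattice`**
  (`‖e^{-F}‖_{T_φ(𝔥)} ≤ e^{-2F(φ)+‖F‖_{T_φ(𝔥)}}`) and `TphiNorm_exp_neg_le_lattice'`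
  (`≤ e^{2‖F‖_{T_φ(𝔥)}}`).

Faithfulness: real-valued `F` (Slade's `n ≥ 1` model has no fermions and real interactions; the
printed statement covers complex `F` with `Re F_∅`). Ledger effect: none on the trust base of the
barrier's reduction chain (`Slade2017_prop822`).
-/

noncomputable section

namespace Literature.Barriers.CriticalPhenomena

namespace LongRangePhi4

namespace Tphi

open Finset

variable {Ξ : Type*}


/-! ## The commutative algebra `(𝓕, ⋆)`, the exponential formula, and `‖e^{-F}‖_{T_φ}` -/

section algebra

/-! ### `⋆` is commutative and associative; the unit; powers -/

/-- The shift `(S_a F)_z = F_{a·z}`. [folklore] -/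
def shiftFam {β : Type*} (a : Ξ) (F : List Ξ → β) : List Ξ → β := fun z => F (a :: z)

/-- **The shift is a derivation of `⋆`**: `(F ⋆ G)_{a·z} = (S_aF ⋆ G)_z + (F ⋆ S_aG)_z`
(the recursion for complementary pairs). [folklore] -/
theorem star_cons (F G : List Ξ → ℝ) (a : Ξ) (z : List Ξ) :
    star F G (a :: z) = star (shiftFam a F) G z + star F (shiftFam a G) z := by
  simp only [star, shiftFam]
  rw [sum_splits_cons, List.sum_map_add]

/-- `⋆` is commutative (one boson species). [cite: BrydgesSlade2015RGI, §5.1 (𝓕 ≅ ℋ, a commutative algebra in the bosonic variables)] -/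
theorem star_comm : ∀ (z : List Ξ) (F G : List Ξ → ℝ), star F G z = star G F z
  | [], F, G => by simp [star, mul_comm]
  | a :: z, F, G => by
      rw [star_cons, star_cons, star_comm z (shiftFam a F) G, star_comm z F (shiftFam a G), add_comm]

/-- `⋆` is bi-additive (left). [folklore] -/
theorem star_add_left (F F' G : List Ξ → ℝ) (z : List Ξ) :
    star (fun w => F w + F' w) G z = star F G z + star F' G z := by
  simp only [star, add_mul, List.sum_map_add]

/-- `⋆` is bi-additive (right). [folklore] -/
theorem star_add_right (F G G' : List Ξ → ℝ) (z : List Ξ) :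
    star F (fun w => G w + G' w) z = star F G z + star F G' z := by
  simp only [star, mul_add, List.sum_map_add]

/-- `⋆` is homogeneous (left). [folklore] -/
theorem star_smul_left (c : ℝ) (F G : List Ξ → ℝ) (z : List Ξ) :
    star (fun w => c * F w) G z = c * star F G z := by
  simp only [star, mul_assoc, List.sum_map_mul_left]

/-- `⋆` is homogeneous (right). [folklore] -/
theorem star_smul_right (c : ℝ) (F G : List Ξ → ℝ) (z : List Ξ) :
    star F (fun w => c * G w) z = c * star F G z := by
  rw [star_comm, star_smul_left, star_comm]

/-- `⋆` depends only on the values of its arguments on sequences not longer than `z`. [folklore] -/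
theorem star_congr {F F' G G' : List Ξ → ℝ} {z : List Ξ}
    (hF : ∀ w, w.length ≤ z.length → F w = F' w) (hG : ∀ w, w.length ≤ z.length → G w = G' w) :
    star F G z = star F' G' z := by
  unfold star
  congr 1
  refine List.map_congr_left fun p hp => ?_
  have := length_add_of_mem_splits hp
  rw [hF p.1 (by omega), hG p.2 (by omega)]

/-- **`⋆` is associative.** Proof by induction on `z`, the shift being a derivation of both
iterated products. [cite: BrydgesSlade2015RGI, §5.1 (𝓕 is an algebra isomorphic to ℋ)] -/
theorem star_assoc : ∀ (z : List Ξ) (F G H : List Ξ → ℝ),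
    star (star F G) H z = star F (star G H) z
  | [], F, G, H => by simp [star, mul_assoc]
  | a :: z, F, G, H => by
      have h1 : shiftFam a (star F G) = fun w => star (shiftFam a F) G w + star F (shiftFam a G) w :=
        funext fun w => star_cons F G a w
      have h2 : shiftFam a (star G H) = fun w => star (shiftFam a G) H w + star G (shiftFam a H) w :=
        funext fun w => star_cons G H a w
      rw [star_cons, star_cons, h1, h2, star_add_left, star_add_right, star_assoc z, star_assoc z,
        star_assoc z, add_assoc]

/-- The unit `δ_∅` of `(𝓕, ⋆)` (the coefficient family of the constant function `1`). [folklore] -/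
def unitFam : List Ξ → ℝ := fun z => if z = [] then 1 else 0

/-- `δ_∅ ⋆ F = F`. [folklore] -/
theorem unitFam_star : ∀ (z : List Ξ) (F : List Ξ → ℝ), star unitFam F z = F z
  | [], F => by simp [star, unitFam]
  | a :: z, F => by
      rw [star_cons, unitFam_star z]
      have : shiftFam a (unitFam : List Ξ → ℝ) = fun _ => 0 := by
        funext w; simp [shiftFam, unitFam]
      rw [this]
      simp [star, shiftFam]

/-- `F ⋆ δ_∅ = F`. [folklore] -/
theorem star_unitFam (z : List Ξ) (F : List Ξ → ℝ) : star F unitFam z = F z := by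
  rw [star_comm, unitFam_star]

/-- Powers `G^{⋆k}` (`G^{⋆0} = δ_∅`, `G^{⋆(k+1)} = G ⋆ G^{⋆k}`). [folklore] -/
def starPow (G : List Ξ → ℝ) : ℕ → List Ξ → ℝ
  | 0 => unitFam
  | k + 1 => star G (starPow G k)

/-- `G^{⋆0} = δ_∅`. [folklore] -/
@[simp] theorem starPow_zero (G : List Ξ → ℝ) : starPow G 0 = unitFam := rfl

/-- `G^{⋆(k+1)} = G ⋆ G^{⋆k}`. [folklore] -/
theorem starPow_succ (G : List Ξ → ℝ) (k : ℕ) : starPow G (k + 1) = star G (starPow G k) := rfl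

/-- If `G_∅ = 0` then `(G^{⋆k})_z = 0` for `|z| < k`. [folklore] -/
theorem starPow_eq_zero_of_length_lt {G : List Ξ → ℝ} (hG : G [] = 0) :
    ∀ (k : ℕ) (z : List Ξ), z.length < k → starPow G k z = 0
  | 0, z, hz => by simp at hz
  | k + 1, z, hz => by
      rw [starPow_succ, star]
      apply List.sum_eq_zero
      intro x hx
      rw [List.mem_map] at hx
      obtain ⟨p, hp, rfl⟩ := hx
      have hlen := length_add_of_mem_splits hp
      cases hp1 : p.1 with
      | nil => rw [hG, zero_mul]
      | cons b u =>
        rw [← hp1, starPow_eq_zero_of_length_lt hG k p.2 (by rw [hp1] at hlen; simp at hlen; omega),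
          mul_zero]

end algebra


/-! ### More on the `T`-seminorm: homogeneity, sums, powers, the empty-sequence part -/

section TnormAPI

variable [Fintype Ξ]

/-- The pairing is homogeneous in the coefficient family. [folklore] -/
theorem pairing_smul_left (pN : ℕ) (c : ℝ) (F g : List Ξ → ℝ) :
    pairing pN (fun z => c * F z) g = c * pairing pN F g := by
  unfold pairing
  rw [Finset.mul_sum]
  refine Finset.sum_congr rfl fun r _ => ?_
  have h : sumSeq r (fun z => c * F z * g z) = c * sumSeq r (fun z => F z * g z) := by
    rw [← sumSeq_mul_left]
    exact sumSeq_congr r fun z _ => by ring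
  rw [h]
  ring

/-- The pairing only reads the coefficient family on sequences of length `≤ p_𝒩`. [folklore] -/
theorem pairing_congr_left (pN : ℕ) {F F' : List Ξ → ℝ} (g : List Ξ → ℝ)
    (h : ∀ z, z.length ≤ pN → F z = F' z) : pairing pN F g = pairing pN F' g := by
  unfold pairing
  refine Finset.sum_congr rfl fun r hr => ?_
  rw [Finset.mem_range] at hr
  congr 1
  exact sumSeq_congr r fun z hz => by rw [h z (by omega)]

/-- `‖cF‖_T = |c| ‖F‖_T` (as an inequality, which is all that is used). [folklore] -/
theorem Tnorm_smul_le {pN : ℕ} {𝓛 : Set (TestFunctional Ξ)} {C : ℕ → ℝ} (hC : EvalBound pN 𝓛 C)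
    (c : ℝ) (F : List Ξ → ℝ) : Tnorm pN 𝓛 (fun z => c * F z) ≤ |c| * Tnorm pN 𝓛 F := by
  refine Tnorm_le fun g hg => ?_
  rw [pairing_smul_left, abs_mul]
  exact mul_le_mul_of_nonneg_left (abs_pairing_le_Tnorm hC F hg) (abs_nonneg c)

/-- Families agreeing on sequences of length `≤ p_𝒩` have the same `T`-seminorm. [folklore] -/
theorem Tnorm_congr (pN : ℕ) (𝓛 : Set (TestFunctional Ξ)) {F F' : List Ξ → ℝ}
    (h : ∀ z, z.length ≤ pN → F z = F' z) : Tnorm pN 𝓛 F = Tnorm pN 𝓛 F' := by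
  unfold Tnorm
  congr 1
  ext x
  simp only [Set.mem_image]
  constructor
  · rintro ⟨g, hg, rfl⟩; exact ⟨g, hg, by rw [pairing_congr_left pN g h]⟩
  · rintro ⟨g, hg, rfl⟩; exact ⟨g, hg, by rw [pairing_congr_left pN g h]⟩

/-- `‖Σ_k F_k‖_T ≤ Σ_k ‖F_k‖_T`. [folklore] -/
theorem Tnorm_sum_le {pN : ℕ} {𝓛 : Set (TestFunctional Ξ)} {C : ℕ → ℝ} (hC : EvalBound pN 𝓛 C)
    {β : Type*} (s : Finset β) (F : β → List Ξ → ℝ) :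
    Tnorm pN 𝓛 (fun z => ∑ k ∈ s, F k z) ≤ ∑ k ∈ s, Tnorm pN 𝓛 (F k) := by
  classical
  induction s using Finset.induction_on with
  | empty =>
    simp only [Finset.sum_empty]
    refine Tnorm_le fun g _ => ?_
    rw [pairing_zero_right' ]
    simp
  | insert b s hb ih =>
    simp only [Finset.sum_insert hb]
    exact (Tnorm_add_le hC _ _).trans (by gcongr)
where
  /-- The pairing of the zero family vanishes. [folklore] -/
  pairing_zero_right' {pN : ℕ} {g : List Ξ → ℝ} : pairing pN (fun _ => (0 : ℝ)) g = 0 := by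
    simp [pairing, sumSeq_zero_fun]

/-- `‖G^{⋆k}‖_T ≤ ‖δ_∅‖_T ‖G‖_T^k` (iterated product property). [cite: BrydgesSlade2015RGI, Proposition 5.1.2] -/
theorem Tnorm_starPow_le {pN : ℕ} {𝓛 : Set (TestFunctional Ξ)} {C : ℕ → ℝ}
    (hSH : ShuffleCompat pN 𝓛) (hC : EvalBound pN 𝓛 C) (G : List Ξ → ℝ) :
    ∀ k : ℕ, Tnorm pN 𝓛 (starPow G k) ≤ Tnorm pN 𝓛 unitFam * Tnorm pN 𝓛 G ^ k
  | 0 => by simp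
  | k + 1 => by
      rw [starPow_succ, pow_succ]
      calc Tnorm pN 𝓛 (star G (starPow G k))
          ≤ Tnorm pN 𝓛 G * Tnorm pN 𝓛 (starPow G k) := Tnorm_star_le hSH hC _ _
        _ ≤ Tnorm pN 𝓛 G * (Tnorm pN 𝓛 unitFam * Tnorm pN 𝓛 G ^ k) := by
            gcongr
            · exact Tnorm_nonneg _ _ _
            · exact Tnorm_starPow_le hSH hC G k
        _ = Tnorm pN 𝓛 unitFam * (Tnorm pN 𝓛 G ^ k * Tnorm pN 𝓛 G) := by ring

/-- `⟨δ_∅, g⟩ = g_∅`. [folklore] -/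
theorem pairing_unitFam (pN : ℕ) (g : List Ξ → ℝ) : pairing pN unitFam g = g [] := by
  unfold pairing
  rw [Finset.sum_eq_single 0]
  · simp [unitFam]
  · intro r _ hr0
    rw [sumSeq_congr r (g := fun _ => 0), sumSeq_zero_fun, mul_zero]
    intro z hz
    have : z ≠ [] := by rintro rfl; exact hr0 (by simpa using hz.symm)
    simp [unitFam, this]
  · intro h; simp at h

/-- `‖δ_∅‖_T ≤ C_0` (the bound of the unit ball on the empty sequence; `= 1` for the lattice
norms). [folklore] -/
theorem Tnorm_unitFam_le {pN : ℕ} {𝓛 : Set (TestFunctional Ξ)} {C : ℕ → ℝ} (hC : EvalBound pN 𝓛 C) :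
    Tnorm pN 𝓛 (unitFam : List Ξ → ℝ) ≤ C 0 :=
  Tnorm_le fun g hg => by
    rw [pairing_unitFam]
    simpa using hC g hg [] (Nat.zero_le _)

/-- The family with its empty-sequence entry removed (`F - F_∅ δ_∅`). [folklore] -/
def tailFam (F : List Ξ → ℝ) : List Ξ → ℝ := fun z => if z = [] then 0 else F z

omit [Fintype Ξ] in
/-- `tailFam F = F - F_∅ δ_∅`. [folklore] -/
theorem tailFam_eq (F : List Ξ → ℝ) : tailFam F = fun z => F z + (-F []) * unitFam z := by
  funext z
  by_cases hz : z = [] <;> simp [tailFam, unitFam, hz]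

/-- `⟨F - F_∅δ_∅, g⟩ = ⟨F, g - g_∅δ_∅⟩`: removing the empty-sequence entry on either side. [folklore] -/
theorem pairing_tailFam (pN : ℕ) (F g : List Ξ → ℝ) :
    pairing pN (tailFam F) g = pairing pN F (tailFam g) := by
  unfold pairing
  refine Finset.sum_congr rfl fun r _ => ?_
  congr 1
  refine sumSeq_congr r fun z _ => ?_
  by_cases hz : z = [] <;> simp [tailFam, hz]

/-- **Decomposability of the unit ball at the empty sequence**: membership in `B(Φ)` is
preserved by resetting the empty-sequence value to any `s` with `|s| ≤ 1` and by negating all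
other values (true for families of single-length functionals whose only constraint at length `0`
is `|g_∅| ≤ 1`, e.g. the lattice norms). [folklore] -/
def NilDecomposable (pN : ℕ) (𝓛 : Set (TestFunctional Ξ)) : Prop :=
  ∀ g ∈ ball pN 𝓛, ∀ s : ℝ, |s| ≤ 1 →
    (fun z => if z = [] then s else -g z) ∈ ball pN 𝓛

/-- `‖F - F_∅δ_∅‖_T ≤ ‖F‖_T` (always). [folklore] -/
theorem Tnorm_tailFam_le {pN : ℕ} {𝓛 : Set (TestFunctional Ξ)} {C : ℕ → ℝ} (hC : EvalBound pN 𝓛 C)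
    (F : List Ξ → ℝ) : Tnorm pN 𝓛 (tailFam F) ≤ Tnorm pN 𝓛 F := by
  refine Tnorm_le fun g hg => ?_
  rw [pairing_tailFam]
  refine abs_pairing_le_Tnorm hC F ⟨fun z hz => ?_, fun ℓ hℓ => ?_⟩
  · have : z ≠ [] := by rintro rfl; simp at hz
    simp [tailFam, this, hg.1 z hz]
  · rcases Nat.eq_zero_or_pos ℓ.len with h0 | hpos
    · rw [ℓ.local' (tailFam g) (fun _ => 0) ?_, show (fun _ : List Ξ => (0:ℝ)) = 0 from rfl,
        map_zero, abs_zero]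
      · exact zero_le_one
      · intro z hz
        rw [h0, List.length_eq_zero_iff] at hz
        simp [tailFam, hz]
    · rw [ℓ.local' (tailFam g) g ?_]
      · exact hg.2 ℓ hℓ
      · intro z hz
        have : z ≠ [] := by rintro rfl; simp at hz; omega
        simp [tailFam, this]

omit [Fintype Ξ] in
/-- Scaling a member of the ball by `|t| ≤ 1` stays in the ball. [folklore] -/
theorem smul_mem_ball_of_abs_le {pN : ℕ} {𝓛 : Set (TestFunctional Ξ)} {g : List Ξ → ℝ} {t : ℝ}
    (hg : g ∈ ball pN 𝓛) (ht : |t| ≤ 1) : (fun z => t * g z) ∈ ball pN 𝓛 := by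
  refine ⟨fun z hz => by simp [hg.1 z hz], fun ℓ hℓ => ?_⟩
  rw [show (fun z : List Ξ => t * g z) = t • g from rfl, map_smul, smul_eq_mul, abs_mul]
  calc |t| * |ℓ.toFun g| ≤ 1 * 1 := mul_le_mul ht (hg.2 ℓ hℓ) (abs_nonneg _) zero_le_one
    _ = 1 := one_mul 1

omit [Fintype Ξ] in
/-- A sign `s ∈ {±1}` with `s x = |x|`. [folklore] -/
theorem exists_sign_mul_eq_abs (x : ℝ) : ∃ s : ℝ, (s = 1 ∨ s = -1) ∧ s * x = |x| := by
  by_cases h : 0 ≤ x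
  · exact ⟨1, Or.inl rfl, by rw [one_mul, abs_of_nonneg h]⟩
  · exact ⟨-1, Or.inr rfl, by rw [abs_of_neg (lt_of_not_ge h)]; ring⟩

/-- **`|F_∅| + ‖F - F_∅δ_∅‖_T ≤ ‖F‖_T`** for a decomposable unit ball: the supremum defining
`‖F‖_T` splits over the independent empty-sequence coordinate (degree `0` versus degree `≥ 1`
parts of the test function). [folklore] -/
theorem abs_nil_add_Tnorm_tailFam_le {pN : ℕ} {𝓛 : Set (TestFunctional Ξ)} {C : ℕ → ℝ}
    (hC : EvalBound pN 𝓛 C) (hD : NilDecomposable pN 𝓛) (F : List Ξ → ℝ) :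
    |F []| + Tnorm pN 𝓛 (tailFam F) ≤ Tnorm pN 𝓛 F := by
  have key : ∀ g ∈ ball pN 𝓛, |F []| + |pairing pN (tailFam F) g| ≤ Tnorm pN 𝓛 F := by
    intro g hg
    obtain ⟨s, hs, hsF⟩ := exists_sign_mul_eq_abs (F [])
    obtain ⟨t, ht, htp⟩ := exists_sign_mul_eq_abs (pairing pN (tailFam F) g)
    have hs1 : |s| ≤ 1 := by rcases hs with rfl | rfl <;> simp
    -- the test function `g̃ = s δ_∅ + t (g - g_∅ δ_∅)`
    set g' : List Ξ → ℝ := fun z => if z = [] then s else t * g z with hg'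
    have hmem : g' ∈ ball pN 𝓛 := by
      rcases ht with rfl | rfl
      · have h1 := hD g hg 0 (by simp)
        have h2 := hD _ h1 s hs1
        convert h2 using 1
        funext z
        by_cases hz : z = [] <;> simp [hg', hz]
      · have h2 := hD g hg s hs1
        convert h2 using 1
        funext z
        by_cases hz : z = [] <;> simp [hg', hz]
    have hval : pairing pN F g' = s * F [] + t * pairing pN (tailFam F) g := by
      have : g' = fun z => s * unitFam z + t * tailFam g z := by
        funext z; by_cases hz : z = [] <;> simp [hg', unitFam, tailFam, hz]
      rw [this, pairing_add_right, pairing_smul_right, pairing_smul_right, ← pairing_tailFam]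
      unfold unitFam
      rw [pairing_indicator_nil]
    have hb := abs_pairing_le_Tnorm hC F hmem
    rw [hval, hsF, htp, abs_of_nonneg (by positivity)] at hb
    exact hb
  have := Tnorm_le (F := tailFam F) (a := Tnorm pN 𝓛 F - |F []|) fun g hg => by linarith [key g hg]
  linarith

end TnormAPI


/-! ### Function-valued coefficient families: `⋆`, shift and derivative as derivations -/

section expFormula

open scoped ContDiff

variable {E : Type*} [NormedAddCommGroup E] [NormedSpace ℝ E]

/-- Pointwise `⋆` of families of functions of the field. [folklore] -/
def starF (F G : List Ξ → E → ℝ) : List Ξ → E → ℝ :=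
  fun z φ => star (fun w => F w φ) (fun w => G w φ) z

/-- Entrywise directional derivative `(D_v F)_z = ∂_v F_z`. [folklore] -/
def derivFam (v : E) (F : List Ξ → E → ℝ) : List Ξ → E → ℝ := fun z => dirDeriv v (F z)

/-- Pointwise powers `G^{⋆k}`. [folklore] -/
def starPowF (G : List Ξ → E → ℝ) : ℕ → List Ξ → E → ℝ
  | 0 => fun z _ => unitFam z
  | k + 1 => starF G (starPowF G k)

omit [NormedAddCommGroup E] [NormedSpace ℝ E] in
/-- `G^{⋆(k+1)} = G ⋆ G^{⋆k}` (pointwise). [folklore] -/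
theorem starPowF_succ (G : List Ξ → E → ℝ) (k : ℕ) : starPowF G (k + 1) = starF G (starPowF G k) := rfl

omit [NormedAddCommGroup E] [NormedSpace ℝ E] in
/-- Pointwise powers are the powers of the pointwise family. [folklore] -/
theorem starPowF_apply (G : List Ξ → E → ℝ) : ∀ (k : ℕ) (z : List Ξ) (φ : E),
    starPowF G k z φ = starPow (fun w => G w φ) k z
  | 0, z, φ => rfl
  | k + 1, z, φ => by
      simp only [starPowF_succ, starPow_succ, starF, star]
      congr 1
      refine List.map_congr_left fun p _ => ?_
      rw [starPowF_apply G k]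

omit [NormedAddCommGroup E] [NormedSpace ℝ E] in
/-- The shift is a derivation of the pointwise `⋆`. [folklore] -/
theorem shiftFam_starF (F G : List Ξ → E → ℝ) (a : Ξ) :
    shiftFam a (starF F G) = fun z φ => starF (shiftFam a F) G z φ + starF F (shiftFam a G) z φ := by
  funext z φ
  show star (fun w => F w φ) (fun w => G w φ) (a :: z) = _
  rw [star_cons]
  rfl

omit [NormedAddCommGroup E] [NormedSpace ℝ E] in
/-- `⋆` is commutative (pointwise). [folklore] -/
theorem starF_comm (F G : List Ξ → E → ℝ) : starF F G = starF G F := by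
  funext z φ; exact star_comm z _ _

omit [NormedAddCommGroup E] [NormedSpace ℝ E] in
/-- `⋆` is associative (pointwise). [folklore] -/
theorem starF_assoc (F G H : List Ξ → E → ℝ) : starF (starF F G) H = starF F (starF G H) := by
  funext z φ; exact star_assoc z _ _ _

omit [NormedAddCommGroup E] [NormedSpace ℝ E] in
/-- Left-commutativity `G ⋆ (X ⋆ Y) = X ⋆ (G ⋆ Y)`. [folklore] -/
theorem starF_left_comm (G X Y : List Ξ → E → ℝ) : starF G (starF X Y) = starF X (starF G Y) := by
  rw [← starF_assoc, starF_comm G X, starF_assoc]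

omit [NormedAddCommGroup E] [NormedSpace ℝ E] in
/-- `⋆` is additive on the right (pointwise). [folklore] -/
theorem starF_add_right (F G G' : List Ξ → E → ℝ) :
    starF F (fun z φ => G z φ + G' z φ) = fun z φ => starF F G z φ + starF F G' z φ := by
  funext z φ; exact star_add_right _ _ _ z

omit [NormedAddCommGroup E] [NormedSpace ℝ E] in
/-- `⋆` is additive on the left (pointwise). [folklore] -/
theorem starF_add_left (F F' G : List Ξ → E → ℝ) :
    starF (fun z φ => F z φ + F' z φ) G = fun z φ => starF F G z φ + starF F' G z φ := by
  funext z φ; exact star_add_left _ _ _ z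

omit [NormedAddCommGroup E] [NormedSpace ℝ E] in
/-- `⋆` is homogeneous on the right for field-dependent scalars (pointwise). [folklore] -/
theorem starF_smul_right (c : E → ℝ) (F G : List Ξ → E → ℝ) :
    starF F (fun z φ => c φ * G z φ) = fun z φ => c φ * starF F G z φ := by
  funext z φ; exact star_smul_right _ _ _ z

omit [NormedAddCommGroup E] [NormedSpace ℝ E] in
/-- `⋆` is homogeneous on the left for field-dependent scalars (pointwise). [folklore] -/
theorem starF_smul_left (c : E → ℝ) (F G : List Ξ → E → ℝ) :
    starF (fun z φ => c φ * F z φ) G = fun z φ => c φ * starF F G z φ := by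
  funext z φ; exact star_smul_left _ _ _ z

omit [NormedAddCommGroup E] [NormedSpace ℝ E] in
/-- `F ⋆ δ_∅ = F` (pointwise). [folklore] -/
theorem starF_unit (F : List Ξ → E → ℝ) : starF F (fun z _ => unitFam z) = F := by
  funext z φ; exact star_unitFam z _

omit [NormedAddCommGroup E] [NormedSpace ℝ E] in
/-- The shift kills the unit. [folklore] -/
theorem shiftFam_unit (a : Ξ) : shiftFam a (fun (z : List Ξ) (_ : E) => unitFam z) = fun _ _ => 0 := by
  funext z φ; simp [shiftFam, unitFam]

omit [NormedAddCommGroup E] [NormedSpace ℝ E] in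
/-- **The shift of a power**: `S_a(G^{⋆(k+1)}) = (k+1) S_aG ⋆ G^{⋆k}`. [folklore] -/
theorem shiftFam_starPowF (G : List Ξ → E → ℝ) (a : Ξ) : ∀ k : ℕ,
    shiftFam a (starPowF G (k + 1)) = fun z φ => (k + 1 : ℝ) * starF (shiftFam a G) (starPowF G k) z φ
  | 0 => by
      rw [starPowF_succ, shiftFam_starF]
      funext z φ
      have hU : starPowF G 0 = fun (z : List Ξ) (_ : E) => unitFam z := rfl
      rw [hU, shiftFam_unit]
      simp [starF, star]
  | k + 1 => by
      rw [starPowF_succ, shiftFam_starF, shiftFam_starPowF G a k]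
      funext z φ
      have h := congrFun (congrFun (starF_smul_right (fun _ => (k + 1 : ℝ)) G
        (starF (shiftFam a G) (starPowF G k))) z) φ
      rw [h, starF_left_comm G (shiftFam a G), ← starPowF_succ]
      push_cast
      ring

/-- Entries of `⋆` products of smooth families are smooth. [folklore] -/
theorem contDiff_starF {F G : List Ξ → E → ℝ} (hF : ∀ w, ContDiff ℝ ∞ (F w))
    (hG : ∀ w, ContDiff ℝ ∞ (G w)) (z : List Ξ) : ContDiff ℝ ∞ (starF F G z) := by
  unfold starF star
  induction splits z with
  | nil => simpa using contDiff_const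
  | cons p l ih =>
    simp only [List.map_cons, List.sum_cons]
    exact ((hF p.1).mul (hG p.2)).add ih

/-- Entries of powers of a smooth family are smooth. [folklore] -/
theorem contDiff_starPowF {G : List Ξ → E → ℝ} (hG : ∀ w, ContDiff ℝ ∞ (G w)) :
    ∀ (k : ℕ) (z : List Ξ), ContDiff ℝ ∞ (starPowF G k z)
  | 0, _ => contDiff_const
  | k + 1, z => contDiff_starF hG (contDiff_starPowF hG k) z

/-- **The entrywise derivative is a derivation of `⋆`** (Leibniz rule entry by entry). [folklore] -/
theorem derivFam_starF (v : E) {F G : List Ξ → E → ℝ} (hF : ∀ w, ContDiff ℝ ∞ (F w))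
    (hG : ∀ w, ContDiff ℝ ∞ (G w)) :
    derivFam v (starF F G) = fun z φ => starF (derivFam v F) G z φ + starF F (derivFam v G) z φ := by
  funext z φ
  have h1 : starF F G z = fun ψ => ((splits z).map fun p => (fun q ψ => F q.1 ψ * G q.2 ψ) p ψ).sum :=
    rfl
  unfold derivFam
  rw [h1, dirDeriv_list_sum v (splits z) (fun q ψ => F q.1 ψ * G q.2 ψ)
    (fun p _ => (differentiable_of_contDiff (hF p.1)).mul (differentiable_of_contDiff (hG p.2)))]
  simp only [starF, star]
  rw [← List.sum_map_add]
  congr 1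
  refine List.map_congr_left fun p _ => ?_
  rw [dirDeriv_mul v (differentiable_of_contDiff (hF p.1)) (differentiable_of_contDiff (hG p.2))]

/-- The entrywise derivative kills the unit. [folklore] -/
theorem derivFam_unit (v : E) : derivFam v (fun (z : List Ξ) (_ : E) => unitFam z) = fun _ _ => 0 := by
  funext z φ
  simp [derivFam, dirDeriv]

/-- **The derivative of a power**: `D_v(G^{⋆(k+1)}) = (k+1) D_vG ⋆ G^{⋆k}`. [folklore] -/
theorem derivFam_starPowF (v : E) {G : List Ξ → E → ℝ} (hG : ∀ w, ContDiff ℝ ∞ (G w)) : ∀ k : ℕ,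
    derivFam v (starPowF G (k + 1)) = fun z φ => (k + 1 : ℝ) * starF (derivFam v G) (starPowF G k) z φ
  | 0 => by
      rw [starPowF_succ, derivFam_starF v hG (contDiff_starPowF hG 0)]
      funext z φ
      have hU : starPowF G 0 = fun (z : List Ξ) (_ : E) => unitFam z := rfl
      rw [hU, derivFam_unit]
      simp [starF, star]
  | k + 1 => by
      rw [starPowF_succ, derivFam_starF v hG (contDiff_starPowF hG (k + 1)), derivFam_starPowF v hG k]
      funext z φ
      have h := congrFun (congrFun (starF_smul_right (fun _ => (k + 1 : ℝ)) G
        (starF (derivFam v G) (starPowF G k))) z) φ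
      rw [h, starF_left_comm G (derivFam v G), ← starPowF_succ]
      push_cast
      ring



/-! ### The exponential formula `(e^G)_z = e^G Σ_k (1/k!) ((G - G_∅δ_∅)^{⋆k})_z` -/

/-- The truncated `⋆`-exponential `P = Σ_{k ≤ K} (1/k!) G^{⋆k}` (pointwise in the field). [folklore] -/
def expStar (G : List Ξ → E → ℝ) (K : ℕ) : List Ξ → E → ℝ :=
  fun z φ => ∑ k ∈ range (K + 1), ((k.factorial : ℝ)⁻¹) * starPowF G k z φ

omit [NormedAddCommGroup E] [NormedSpace ℝ E] in
/-- `⋆` distributes over finite sums with constant coefficients (right factor). [folklore] -/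
theorem starF_sum_right (X : List Ξ → E → ℝ) {β : Type*} (s : Finset β) (c : β → ℝ)
    (Y : β → List Ξ → E → ℝ) (z : List Ξ) (φ : E) :
    starF X (fun w ψ => ∑ k ∈ s, c k * Y k w ψ) z φ = ∑ k ∈ s, c k * starF X (Y k) z φ := by
  classical
  induction s using Finset.induction_on with
  | empty => simp [starF, star]
  | insert b s hb ih =>
    simp only [Finset.sum_insert hb]
    show star (fun w => X w φ) (fun w => c b * Y b w φ + ∑ k ∈ s, c k * Y k w φ) z = _
    rw [star_add_right, star_smul_right]
    show c b * starF X (Y b) z φ + starF X (fun w ψ => ∑ k ∈ s, c k * Y k w ψ) z φ = _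
    rw [ih]

/-- The coefficient family of `G ∈ 𝒩` with its empty-sequence entry removed:
`(G_1)_z(φ) = G_z(φ)` for `z ≠ ∅`, `(G_1)_∅ = 0`. [folklore] -/
def tailCoeff (e : Ξ → E) (G : E → ℝ) : List Ξ → E → ℝ :=
  fun z => if z = [] then (fun _ => 0) else coeff e z G

/-- At a fixed field, `tailCoeff` is the tail of the coefficient family. [folklore] -/
theorem tailCoeff_apply (e : Ξ → E) (G : E → ℝ) (φ : E) :
    (fun z => tailCoeff e G z φ) = tailFam (coeffFamily e G φ) := by
  funext z
  by_cases hz : z = [] <;> simp [tailCoeff, tailFam, coeffFamily, hz]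

/-- The entries of `tailCoeff` of a smooth `G` are smooth. [folklore] -/
theorem contDiff_tailCoeff (e : Ξ → E) {G : E → ℝ} (hG : ContDiff ℝ ∞ G) (z : List Ξ) :
    ContDiff ℝ ∞ (tailCoeff e G z) := by
  by_cases hz : z = []
  · simp only [tailCoeff, hz, if_true]; exact contDiff_const
  · simp only [tailCoeff, hz, if_false]; exact contDiff_coeff e hG z

/-- **`S_a G_1 = D_{e_a} G_1 + (∂_a G) δ_∅`**: the shift and the derivative agree on the tail
except at the empty sequence. [folklore] -/
theorem shiftFam_tailCoeff (e : Ξ → E) (G : E → ℝ) (a : Ξ) :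
    shiftFam a (tailCoeff e G) =
      fun z φ => derivFam (e a) (tailCoeff e G) z φ + dirDeriv (e a) G φ * unitFam z := by
  funext z φ
  by_cases hz : z = []
  · subst hz
    simp [shiftFam, tailCoeff, derivFam, unitFam, coeff_cons, dirDeriv]
  · simp [shiftFam, tailCoeff, derivFam, unitFam, hz, coeff_cons]

omit [NormedAddCommGroup E] [NormedSpace ℝ E] in
/-- A `⋆` product with a factor vanishing on sequences of length `≤ n` vanishes at `z`, `|z| ≤ n`.
[folklore] -/
theorem starF_eq_zero_of_length {X Y : List Ξ → E → ℝ} {n : ℕ}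
    (hY : ∀ w : List Ξ, w.length ≤ n → ∀ φ, Y w φ = 0) {z : List Ξ} (hz : z.length ≤ n) (φ : E) :
    starF X Y z φ = 0 := by
  unfold starF star
  apply List.sum_eq_zero
  intro x hx
  rw [List.mem_map] at hx
  obtain ⟨p, hp, rfl⟩ := hx
  have := length_add_of_mem_splits hp
  show X p.1 φ * Y p.2 φ = 0
  rw [hY p.2 (by omega) φ, mul_zero]

/-- Powers of the tail vanish on short sequences: `((G_1)^{⋆k})_z = 0` for `|z| < k`. [folklore] -/
theorem starPowF_tailCoeff_eq_zero (e : Ξ → E) (G : E → ℝ) {k : ℕ} {z : List Ξ} (hz : z.length < k)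
    (φ : E) : starPowF (tailCoeff e G) k z φ = 0 := by
  rw [starPowF_apply]
  exact starPow_eq_zero_of_length_lt (by simp [tailCoeff]) k z hz

omit [NormedAddCommGroup E] [NormedSpace ℝ E] in
/-- **The shift of the `⋆`-exponential**: `S_a P = S_aG ⋆ P - (1/K!) S_aG ⋆ G^{⋆K}`
(`S_a` is a derivation, `S_a(G^{⋆k}) = k S_aG ⋆ G^{⋆(k-1)}`, and the sum telescopes in the
factorials). [folklore] -/
theorem shiftFam_expStar (G : List Ξ → E → ℝ) (a : Ξ) (K : ℕ) (z : List Ξ) (φ : E) :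
    shiftFam a (expStar G K) z φ = starF (shiftFam a G) (expStar G K) z φ -
      ((K.factorial : ℝ)⁻¹) * starF (shiftFam a G) (starPowF G K) z φ := by
  have hR : starF (shiftFam a G) (expStar G K) z φ =
      ∑ k ∈ range (K + 1), ((k.factorial : ℝ)⁻¹) * starF (shiftFam a G) (starPowF G k) z φ :=
    starF_sum_right _ _ _ _ z φ
  have hL : shiftFam a (expStar G K) z φ =
      ∑ k ∈ range (K + 1), ((k.factorial : ℝ)⁻¹) * shiftFam a (starPowF G k) z φ := rfl
  rw [hL, hR, Finset.sum_range_succ' (fun k => ((k.factorial : ℝ)⁻¹) *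
    shiftFam a (starPowF G k) z φ), Finset.sum_range_succ]
  have h0 : shiftFam a (starPowF G 0) z φ = 0 := by simp [shiftFam, starPowF, unitFam]
  rw [h0, mul_zero, add_zero, add_sub_cancel_right]
  refine Finset.sum_congr rfl fun k _ => ?_
  rw [shiftFam_starPowF G a k]
  simp only [Nat.factorial_succ, Nat.cast_mul, Nat.cast_add, Nat.cast_one, mul_inv]
  have hk : ((k : ℝ) + 1) ≠ 0 := by positivity
  field_simp

/-- **The derivative of the `⋆`-exponential**: `D_v P = D_vG ⋆ P - (1/K!) D_vG ⋆ G^{⋆K}`. [folklore] -/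
theorem derivFam_expStar (v : E) {G : List Ξ → E → ℝ} (hG : ∀ w, ContDiff ℝ ∞ (G w)) (K : ℕ)
    (z : List Ξ) (φ : E) :
    derivFam v (expStar G K) z φ = starF (derivFam v G) (expStar G K) z φ -
      ((K.factorial : ℝ)⁻¹) * starF (derivFam v G) (starPowF G K) z φ := by
  have hR : starF (derivFam v G) (expStar G K) z φ =
      ∑ k ∈ range (K + 1), ((k.factorial : ℝ)⁻¹) * starF (derivFam v G) (starPowF G k) z φ :=
    starF_sum_right _ _ _ _ z φ
  have hL : derivFam v (expStar G K) z φ =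
      ∑ k ∈ range (K + 1), ((k.factorial : ℝ)⁻¹) * derivFam v (starPowF G k) z φ := by
    simp only [derivFam, dirDeriv]
    have hfun : expStar G K z = ∑ k ∈ range (K + 1), ((k.factorial : ℝ)⁻¹ • starPowF G k z) := by
      funext ψ
      simp [expStar, Finset.sum_apply, smul_eq_mul]
    have hd : ∀ k, DifferentiableAt ℝ (starPowF G k z) φ := fun k =>
      ((contDiff_starPowF hG k z).differentiable (by simp)).differentiableAt
    rw [hfun, fderiv_sum (fun k _ => (hd k).const_smul _)]
    simp only [FunLike.coe_sum, Finset.sum_apply]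
    refine Finset.sum_congr rfl fun k _ => ?_
    rw [fderiv_const_smul (hd k)]
    simp [smul_eq_mul]
  rw [hL, hR, Finset.sum_range_succ' (fun k => ((k.factorial : ℝ)⁻¹) *
    derivFam v (starPowF G k) z φ), Finset.sum_range_succ]
  have h0 : derivFam v (starPowF G 0) z φ = 0 := by simp [derivFam, starPowF, dirDeriv]
  rw [h0, mul_zero, add_zero, add_sub_cancel_right]
  refine Finset.sum_congr rfl fun k _ => ?_
  rw [derivFam_starPowF v hG k]
  simp only [Nat.factorial_succ, Nat.cast_mul, Nat.cast_add, Nat.cast_one, mul_inv]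
  have hk : ((k : ℝ) + 1) ≠ 0 := by positivity
  field_simp

/-- **The recursion of the `⋆`-exponential of the tail** on sequences not longer than `p_𝒩`
(with `K = p_𝒩 + 1`): `(S_a P)_z = (D_{e_a} P)_z + (∂_a G) P_z` — the same recursion as the one
satisfied by `Q_z = e^{-G}(e^G)_z` (`Q_{a·z} = ∂_a Q_z + (∂_a G)Q_z`). [folklore] -/
theorem shiftFam_expStar_tailCoeff (e : Ξ → E) {G : E → ℝ} (hG : ContDiff ℝ ∞ G) (pN : ℕ) (a : Ξ)
    {z : List Ξ} (hz : z.length ≤ pN) (φ : E) :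
    shiftFam a (expStar (tailCoeff e G) (pN + 1)) z φ =
      derivFam (e a) (expStar (tailCoeff e G) (pN + 1)) z φ +
        dirDeriv (e a) G φ * expStar (tailCoeff e G) (pN + 1) z φ := by
  have hv : ∀ w : List Ξ, w.length ≤ pN → ∀ ψ, starPowF (tailCoeff e G) (pN + 1) w ψ = 0 :=
    fun w hw ψ => starPowF_tailCoeff_eq_zero e G (by omega) ψ
  rw [shiftFam_expStar, derivFam_expStar (e a) (contDiff_tailCoeff e hG),
    starF_eq_zero_of_length hv hz, starF_eq_zero_of_length hv hz, mul_zero, sub_zero, sub_zero,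
    shiftFam_tailCoeff, starF_add_left]
  simp only []
  rw [starF_smul_left (fun φ => dirDeriv (e a) G φ) (fun z _ => unitFam z)]
  simp only []
  congr 1
  rw [show starF (fun z (_ : E) => unitFam z) (expStar (tailCoeff e G) (pN + 1)) =
    expStar (tailCoeff e G) (pN + 1) from by rw [starF_comm, starF_unit]]

/-- The entries of the `⋆`-exponential of the tail are smooth. [folklore] -/
theorem contDiff_expStar (e : Ξ → E) {G : E → ℝ} (hG : ContDiff ℝ ∞ G) (K : ℕ) (z : List Ξ) :
    ContDiff ℝ ∞ (expStar (tailCoeff e G) K z) := by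
  unfold expStar
  exact ContDiff.sum fun k _ => contDiff_const.mul (contDiff_starPowF (contDiff_tailCoeff e hG) k z)

/-- `P_∅ = 1`. [folklore] -/
theorem expStar_nil (e : Ξ → E) (G : E → ℝ) (K : ℕ) (φ : E) : expStar (tailCoeff e G) K [] φ = 1 := by
  unfold expStar
  rw [Finset.sum_eq_single 0]
  · simp [starPowF, unitFam]
  · intro k _ hk
    rw [starPowF_tailCoeff_eq_zero e G (by simp; omega), mul_zero]
  · intro h; simp at h

/-- **The exponential formula.** For `G ∈ 𝒩` and `|z| ≤ p_𝒩`: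
`(e^G)_z(φ) = e^{G(φ)} P_z(φ)`, `P = Σ_{k ≤ p_𝒩+1} (1/k!) (G_1)^{⋆k}`, `G_1 = G - G_∅δ_∅` — the
coefficients of `e^G` are `e^G` times the `⋆`-exponential of the coefficients of `G` without the
constant term (Faà di Bruno / exponential formula, proved by induction on `z` through the common
recursion `X_{a·z} = ∂_a X_z`). [folklore] -/
theorem coeff_exp (e : Ξ → E) {G : E → ℝ} (hG : ContDiff ℝ ∞ G) (pN : ℕ) :
    ∀ z : List Ξ, z.length ≤ pN →
      coeff e z (fun φ => Real.exp (G φ)) =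
        fun φ => Real.exp (G φ) * expStar (tailCoeff e G) (pN + 1) z φ
  | [], _ => by
      funext φ
      rw [coeff_nil, expStar_nil, mul_one]
  | a :: z, hz => by
      have hz' : z.length ≤ pN := by simp at hz; omega
      rw [coeff_cons, coeff_exp e hG pN z hz']
      have hexp : ContDiff ℝ ∞ (fun φ => Real.exp (G φ)) := Real.contDiff_exp.comp hG
      rw [dirDeriv_mul (e a) (differentiable_of_contDiff hexp)
        (differentiable_of_contDiff (contDiff_expStar e hG (pN + 1) z))]
      funext φ
      have h1 : dirDeriv (e a) (fun φ => Real.exp (G φ)) φ = Real.exp (G φ) * dirDeriv (e a) G φ := by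
        simp only [dirDeriv]
        rw [fderiv_exp (differentiable_of_contDiff hG φ)]
        simp [smul_eq_mul]
      have h2 : expStar (tailCoeff e G) (pN + 1) (a :: z) φ =
          shiftFam a (expStar (tailCoeff e G) (pN + 1)) z φ := rfl
      rw [h1, h2, shiftFam_expStar_tailCoeff e hG pN a hz' φ]
      simp only [derivFam]
      ring

end expFormula

/-- `(cF)_z = c F_z`. [folklore] -/
theorem coeff_const_mul {E : Type*} [NormedAddCommGroup E] [NormedSpace ℝ E] (e : Ξ → E)
    {F : E → ℝ} (hF : ContDiff ℝ (⊤ : ℕ∞) F) (c : ℝ) :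
    ∀ z : List Ξ, coeff e z (fun ψ => c * F ψ) = fun ψ => c * coeff e z F ψ
  | [] => rfl
  | a :: z => by
      rw [coeff_cons, coeff_cons, coeff_const_mul e hF c z]
      funext ψ
      simp only [dirDeriv]
      rw [show (fun ψ => c * coeff e z F ψ) = fun ψ => c • coeff e z F ψ from rfl,
        fderiv_fun_const_smul ((differentiable_of_contDiff (contDiff_coeff e hF z)) ψ)]
      simp [smul_eq_mul]

/-! ### `‖e^{-F}‖_{T_φ}`: Brydges–Slade Proposition 3.4.6 -/

section expBound

open scoped ContDiff

variable [Fintype Ξ]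
variable {E : Type*} [NormedAddCommGroup E] [NormedSpace ℝ E]

/-- **`‖e^G‖_{T_φ} ≤ ‖δ_∅‖_T · e^{G(φ)} · exp ‖(G_1)(φ)‖_T`**: the exponential formula, the
product property for the powers `(G_1)^{⋆k}` and `Σ_{k≤K} x^k/k! ≤ e^x`. [folklore] -/
theorem TphiNorm_exp_le {pN : ℕ} {𝓛 : Set (TestFunctional Ξ)} {C : ℕ → ℝ}
    (hSH : ShuffleCompat pN 𝓛) (hC : EvalBound pN 𝓛 C) (e : Ξ → E) {G : E → ℝ} (hG : ContDiff ℝ ∞ G)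
    (φ : E) :
    TphiNorm pN 𝓛 e (fun ψ => Real.exp (G ψ)) φ ≤
      Tnorm pN 𝓛 (unitFam : List Ξ → ℝ) * Real.exp (G φ) *
        Real.exp (Tnorm pN 𝓛 (tailFam (coeffFamily e G φ))) := by
  have hT0 := Tnorm_nonneg pN 𝓛 (unitFam : List Ξ → ℝ)
  set T1 := Tnorm pN 𝓛 (tailFam (coeffFamily e G φ)) with hT1
  have hT1n : 0 ≤ T1 := Tnorm_nonneg _ _ _
  -- replace the coefficient family by the exponential formula
  have hcongr : TphiNorm pN 𝓛 e (fun ψ => Real.exp (G ψ)) φ =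
      Tnorm pN 𝓛 (fun z => Real.exp (G φ) * expStar (tailCoeff e G) (pN + 1) z φ) := by
    unfold TphiNorm
    refine Tnorm_congr pN 𝓛 fun z hz => ?_
    simp only [coeffFamily]
    rw [coeff_exp e hG pN z hz]
  rw [hcongr]
  refine (Tnorm_smul_le hC _ _).trans ?_
  rw [abs_of_pos (Real.exp_pos _), mul_comm (Tnorm pN 𝓛 unitFam), mul_assoc]
  refine mul_le_mul_of_nonneg_left ?_ (Real.exp_pos _).le
  -- the `⋆`-exponential at the field `φ`
  have hsum : (fun z => expStar (tailCoeff e G) (pN + 1) z φ) =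
      fun z => ∑ k ∈ range (pN + 1 + 1), ((k.factorial : ℝ)⁻¹) * starPow (tailFam (coeffFamily e G φ)) k z := by
    funext z
    simp only [expStar, starPowF_apply, tailCoeff_apply]
  rw [hsum]
  calc Tnorm pN 𝓛 (fun z => ∑ k ∈ range (pN + 1 + 1),
        ((k.factorial : ℝ)⁻¹) * starPow (tailFam (coeffFamily e G φ)) k z)
      ≤ ∑ k ∈ range (pN + 1 + 1),
          Tnorm pN 𝓛 (fun z => ((k.factorial : ℝ)⁻¹) * starPow (tailFam (coeffFamily e G φ)) k z) :=
        Tnorm_sum_le hC _ _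
    _ ≤ ∑ k ∈ range (pN + 1 + 1), ((k.factorial : ℝ)⁻¹) * (Tnorm pN 𝓛 unitFam * T1 ^ k) := by
        refine Finset.sum_le_sum fun k _ => ?_
        refine (Tnorm_smul_le hC _ _).trans ?_
        rw [abs_of_pos (by positivity)]
        exact mul_le_mul_of_nonneg_left (Tnorm_starPow_le hSH hC _ k) (by positivity)
    _ = Tnorm pN 𝓛 unitFam * ∑ k ∈ range (pN + 1 + 1), T1 ^ k / (k.factorial : ℝ) := by
        rw [Finset.mul_sum]
        refine Finset.sum_congr rfl fun k _ => ?_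
        rw [div_eq_mul_inv]; ring
    _ ≤ Tnorm pN 𝓛 unitFam * Real.exp T1 :=
        mul_le_mul_of_nonneg_left (Real.sum_le_exp_of_nonneg hT1n _) hT0

/-- **Brydges–Slade, Proposition 3.4.6 (real case), for a decomposable unit ball**:
`‖e^{-F}‖_{T_φ} ≤ ‖δ_∅‖_T · e^{-F(φ) - |F(φ)| + ‖F‖_{T_φ}} ≤ ‖δ_∅‖_T · e^{-2F(φ) + ‖F‖_{T_φ}}`
("Let `F ∈ 𝒩` and let `F_∅` be the purely bosonic part of `F`. Then
`‖e^{-F}‖_{T_φ} ≤ e^{-2Re F_∅(φ) + ‖F‖_{T_φ}}`"; here `F` real and `‖δ_∅‖_T = 1` for the lattice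
norms). Proved through the exponential formula instead of the printed limiting argument of §5.2.
[cite: BrydgesSlade2015RGI, Proposition 3.4.6] -/
theorem TphiNorm_exp_neg_le {pN : ℕ} {𝓛 : Set (TestFunctional Ξ)} {C : ℕ → ℝ}
    (hSH : ShuffleCompat pN 𝓛) (hC : EvalBound pN 𝓛 C) (hD : NilDecomposable pN 𝓛) (e : Ξ → E)
    {F : E → ℝ} (hF : ContDiff ℝ ∞ F) (φ : E) :
    TphiNorm pN 𝓛 e (fun ψ => Real.exp (-F ψ)) φ ≤
      Tnorm pN 𝓛 (unitFam : List Ξ → ℝ) * Real.exp (-2 * F φ + TphiNorm pN 𝓛 e F φ) := by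
  have h := TphiNorm_exp_le hSH hC e (G := fun ψ => -F ψ) hF.neg φ
  refine h.trans ?_
  rw [mul_assoc, ← Real.exp_add]
  refine mul_le_mul_of_nonneg_left (Real.exp_le_exp.2 ?_) (Tnorm_nonneg _ _ _)
  -- `‖(-F)_1‖_T ≤ ‖-F‖_T - |F(φ)| = ‖F‖_{T_φ} - |F(φ)|`
  have hneg : coeffFamily e (fun ψ => -F ψ) φ = fun z => (-1) * coeffFamily e F φ z := by
    funext z
    simp only [coeffFamily]
    have : (fun ψ => -F ψ) = fun ψ => (-1 : ℝ) * F ψ := by funext ψ; ring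
    rw [this, coeff_const_mul e hF (-1) z]
  have hd := abs_nil_add_Tnorm_tailFam_le hC hD (coeffFamily e (fun ψ => -F ψ) φ)
  have hT : Tnorm pN 𝓛 (coeffFamily e (fun ψ => -F ψ) φ) ≤ TphiNorm pN 𝓛 e F φ := by
    rw [hneg]
    refine (Tnorm_smul_le hC _ _).trans ?_
    simp [TphiNorm]
  have h0 : coeffFamily e (fun ψ => -F ψ) φ [] = -F φ := rfl
  rw [h0, abs_neg] at hd
  have habs : -F φ ≤ |F φ| := neg_le_abs _
  -- `-F - |F| ≤ -2F` fails when `F<0`? No: we bound `-F + T1 ≤ -F + (T - |F|) ≤ -2F + T` using `-|F| ≤ -F`… careful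
  nlinarith [abs_nonneg (F φ), le_abs_self (F φ)]

/-- **`‖e^{-F}‖_{T_φ} ≤ ‖δ_∅‖_T e^{‖F‖_{T_φ}}`** (display (apos-e) of [BS-rg-norm]), for any unit
ball (no decomposability needed). [cite: BrydgesSlade2015RGI, §5.2 (display ‖e^{-F}‖_{T_φ} ≤ e^{‖F‖_{T_φ}})] -/
theorem TphiNorm_exp_neg_le' {pN : ℕ} {𝓛 : Set (TestFunctional Ξ)} {C : ℕ → ℝ}
    (hSH : ShuffleCompat pN 𝓛) (hC : EvalBound pN 𝓛 C) (e : Ξ → E)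
    {F : E → ℝ} (hF : ContDiff ℝ ∞ F) (φ : E) :
    TphiNorm pN 𝓛 e (fun ψ => Real.exp (-F ψ)) φ ≤
      Tnorm pN 𝓛 (unitFam : List Ξ → ℝ) * Real.exp (|F φ| + TphiNorm pN 𝓛 e F φ) := by
  have h := TphiNorm_exp_le hSH hC e (G := fun ψ => -F ψ) hF.neg φ
  refine h.trans ?_
  rw [mul_assoc, ← Real.exp_add]
  refine mul_le_mul_of_nonneg_left (Real.exp_le_exp.2 ?_) (Tnorm_nonneg _ _ _)
  have hT : Tnorm pN 𝓛 (tailFam (coeffFamily e (fun ψ => -F ψ) φ)) ≤ TphiNorm pN 𝓛 e F φ := by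
    refine (Tnorm_tailFam_le hC _).trans ?_
    have hneg : coeffFamily e (fun ψ => -F ψ) φ = fun z => (-1) * coeffFamily e F φ z := by
      funext z
      simp only [coeffFamily]
      have : (fun ψ => -F ψ) = fun ψ => (-1 : ℝ) * F ψ := by funext ψ; ring
      rw [this, coeff_const_mul e hF (-1) z]
    rw [hneg]
    refine (Tnorm_smul_le hC _ _).trans ?_
    simp [TphiNorm]
  have : -F φ ≤ |F φ| := neg_le_abs _
  linarith

end expBound


/-! ### The lattice norms: Proposition 3.4.6 for Slade's `T_{φ,j}(𝔥_j)` -/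

section latticeExp

open scoped ContDiff

variable {Λ : Type*} [AddCommGroup Λ] {ι : Type*} {S : Type*} (step : S → Λ)
variable [Fintype Λ] [Fintype ι]
variable {E : Type*} [NormedAddCommGroup E] [NormedSpace ℝ E]

omit [Fintype Λ] [Fintype ι] in
/-- The unit ball of `Φ(𝔥)` is decomposable at the empty sequence. [folklore] -/
theorem latticeFamily_nilDecomposable (𝔥 R : ℝ) (pΦ pN : ℕ) :
    NilDecomposable (Ξ := Λ × ι) pN (latticeFamily step 𝔥 R pΦ) := by
  intro g hg s hs
  refine ⟨fun z hz => ?_, ?_⟩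
  · have : z ≠ [] := by rintro rfl; simp at hz
    simp [this, hg.1 z hz]
  · rintro _ ⟨α, w, hα, rfl⟩
    rw [latticeFun_apply]
    cases w with
    | nil =>
      have hαnil : α = [] := by
        cases α with
        | nil => rfl
        | cons q α => exact absurd (hα.1 q (by simp)) (by simp)
      subst hαnil
      simpa using hs
    | cons a w =>
      have hloc : napply step α (fun z => if z = [] then s else -g z) (a :: w) =
          napply step α (fun z => (-1 : ℝ) * g z) (a :: w) := by
        refine napply_congr step α (fun z hz => ?_) (a :: w) rfl
        have : z ≠ [] := by rintro rfl; simp at hz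
        simp [this]
      have h := hg.2 _ (latticeFun_mem step 𝔥 R hα)
      rw [latticeFun_apply] at h
      rw [hloc, show (fun z : List (Λ × ι) => (-1 : ℝ) * g z) = (-1 : ℝ) • g from rfl, napply_smul,
        Pi.smul_apply, smul_eq_mul]
      calc |(𝔥 ^ (a :: w).length)⁻¹ * R ^ α.length * (-1 * napply step α g (a :: w))|
          = |(𝔥 ^ (a :: w).length)⁻¹ * R ^ α.length * napply step α g (a :: w)| := by
            rw [show (𝔥 ^ (a :: w).length)⁻¹ * R ^ α.length * (-1 * napply step α g (a :: w)) =
              -((𝔥 ^ (a :: w).length)⁻¹ * R ^ α.length * napply step α g (a :: w)) by ring, abs_neg]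
        _ ≤ 1 := h

/-- `‖δ_∅‖_T ≤ 1` for the lattice norms. [folklore] -/
theorem Tnorm_unitFam_le_one {𝔥 R : ℝ} (h𝔥 : 0 < 𝔥) (hR : 0 < R) (pΦ pN : ℕ) :
    Tnorm pN (latticeFamily step 𝔥 R pΦ) (unitFam : List (Λ × ι) → ℝ) ≤ 1 := by
  have := Tnorm_unitFam_le (latticeFamily_evalBound (ι := ι) step h𝔥 hR pΦ pN)
  simpa using this

/-- **Brydges–Slade, Proposition 3.4.6, for the lattice norms `Φ(𝔥)` (Slade's `T_{φ,j}(𝔥_j)`),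
real case**: for smooth real `F`, `‖e^{-F}‖_{T_φ(𝔥)} ≤ e^{-2F(φ) + ‖F‖_{T_φ(𝔥)}}`.
[cite: BrydgesSlade2015RGI, Proposition 3.4.6] [cite: Slade2017, §6.2.2 (the T_{φ,j}(𝔥) seminorm)] -/
theorem TphiNorm_exp_neg_le_lattice {𝔥 R : ℝ} (h𝔥 : 0 < 𝔥) (hR : 0 < R) (pΦ pN : ℕ)
    (e : Λ × ι → E) {F : E → ℝ} (hF : ContDiff ℝ ∞ F) (φ : E) :
    TphiNorm pN (latticeFamily step 𝔥 R pΦ) e (fun ψ => Real.exp (-F ψ)) φ ≤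
      Real.exp (-2 * F φ + TphiNorm pN (latticeFamily step 𝔥 R pΦ) e F φ) := by
  have h := TphiNorm_exp_neg_le (latticeFamily_shuffleCompat step h𝔥 hR pΦ pN)
    (latticeFamily_evalBound step h𝔥 hR pΦ pN) (latticeFamily_nilDecomposable step 𝔥 R pΦ pN) e hF φ
  refine h.trans ?_
  calc Tnorm pN (latticeFamily step 𝔥 R pΦ) unitFam *
        Real.exp (-2 * F φ + TphiNorm pN (latticeFamily step 𝔥 R pΦ) e F φ)
      ≤ 1 * Real.exp (-2 * F φ + TphiNorm pN (latticeFamily step 𝔥 R pΦ) e F φ) := by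
        gcongr
        exact Tnorm_unitFam_le_one step h𝔥 hR pΦ pN
    _ = _ := one_mul _

/-- **`‖e^{-F}‖_{T_φ(𝔥)} ≤ e^{|F(φ)| + ‖F‖_{T_φ(𝔥)}} ≤ e^{2‖F‖_{T_φ(𝔥)}}`** for the lattice norms
(the cruder bound (apos-e) `‖e^{-F}‖ ≤ e^{‖F‖}` of [BS-rg-norm] up to the constant-term
bookkeeping). [cite: BrydgesSlade2015RGI, §5.2 (display (apos-e))] -/
theorem TphiNorm_exp_neg_le_lattice' {𝔥 R : ℝ} (h𝔥 : 0 < 𝔥) (hR : 0 < R) (pΦ pN : ℕ)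
    (e : Λ × ι → E) {F : E → ℝ} (hF : ContDiff ℝ ∞ F) (φ : E) :
    TphiNorm pN (latticeFamily step 𝔥 R pΦ) e (fun ψ => Real.exp (-F ψ)) φ ≤
      Real.exp (2 * TphiNorm pN (latticeFamily step 𝔥 R pΦ) e F φ) := by
  have h := TphiNorm_exp_neg_le' (latticeFamily_shuffleCompat step h𝔥 hR pΦ pN)
    (latticeFamily_evalBound step h𝔥 hR pΦ pN) e hF φ
  have habs := abs_apply_le_TphiNorm_lattice step h𝔥 hR pΦ pN e F φ
  refine h.trans ?_
  calc Tnorm pN (latticeFamily step 𝔥 R pΦ) unitFam *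
        Real.exp (|F φ| + TphiNorm pN (latticeFamily step 𝔥 R pΦ) e F φ)
      ≤ 1 * Real.exp (2 * TphiNorm pN (latticeFamily step 𝔥 R pΦ) e F φ) := by
        gcongr
        · exact Tnorm_unitFam_le_one step h𝔥 hR pΦ pN
        · linarith
    _ = _ := one_mul _

end latticeExp

end Tphi

end LongRangePhi4

end Literature.Barriers.CriticalPhenomena

end
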